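import Summits.HubbardSuperconductivity.HubbardSuperconductivity.Theorems.AnisotropyChordInsertionEntropyOneState
import Summits.HubbardSuperconductivity.HubbardSuperconductivity.Theorems.AnisotropyChordInsertionEntropyUniformDensity
import Summits.HubbardSuperconductivity.HubbardSuperconductivity.Theorems.AnisotropyChordInsertionEntropyLatticeSum
import Summits.HubbardSuperconductivity.HubbardSuperconductivity.Theorems.AnisotropyChordInsertionEntropyFourier

/-!
# Route `AnisotropyChord` / H0 rotor rung: the ONE-STATE condensation crux `TeleEntropyBound` (H1‴), its
# Gaussian form `TeleGaussianComparison` (H1⁗), and the PROVED one-state skeleton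
# (theory seat `hubbard-h0-rotor-theory-1`, cycle 9, memo ROTOR-THEORY-9 §130(d), §133; Sketch9 Parts D–E ported,
# work-order W13)

Part D.  On the XXZ torus `H(Δ) = xxzHamiltonian 1 (torusGraph 2 L) (−1) Δ`, Perron sector ground amplitudes have
uniform site density (tree `siteDensity_eq_of_isPerron`) and `N`-sector support (tree
`card_filter_eq_zero_of_mem_sector`), so the one-state E-floor (`condensateDensity_ge_of_teleEntropy'`) turns a
uniform bound on the teleportation entropies into eventual condensation — with ONE Perron amplitude per `L`
(no `M L − 1` sector, no `PerronSectorExists`, no two-sector density window):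
* `TeleEntropyBound Δ M` (H1‴, typed; OPEN);
* `condensateDensity_ge_of_isPerron_tele` : `n₀/|Λ| ≥ ρ_L(1 − ρ_L) e^{−K/2}`;
* **`eventualCondensate_of_teleEntropyBound`** : `ρ_L → ρ ∈ (0,1) → TeleEntropyBound Δ M → EventualCondensate Δ M`.

Part E.  The one-state GAUSSIAN («harmonic-fluid») value
`vG(x,y) = |Λ|⁻¹ Σ_{k≠0} (S(k)/(1−ρ) − 1)² |1 − e^{ik·(y−x)}|² / (4ρ S(k))` of `D_½(ν_x^{(y)}, ν_y^{(x)})`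
(kernel `û = (S/(1−ρ) − 1)/(2ρS)`; numerically `D_½/vG → 1`, kit j302283/j302351, HOME cycle9/TELE-TABLE.md):
* `teleGaussianEntropy`, the comparison crux `TeleGaussianComparison Δ M` (H1⁗, typed; OPEN), and the
  `N`-sector transcriptions `InfraredStructureBoundN` ((IR_α)^N) and `StructureFactorUpperN` ((S_max)^N) of the
  tree's two-sector hypotheses;
* `teleGaussianEntropy_le` : `vG ≤ ((S_max/(1−ρ) + 1)²/(ρ c)) · L⁻² Σ_{k≠0} |k|_T^{−α}` under `c|k|^α ≤ S ≤ S_max`;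
* **`teleEntropyBound_of_gaussianComparison`** : H1⁗ ∧ (IR_α)^N ∧ (S_max)^N ∧ ρ_L → ρ ⇒ H1‴ (tree lattice
  lemma `sum_rpow_neg_torusNorm_le`);
* **`eventualCondensate_of_teleGaussianComparison`** : the one-state skeleton, every hypothesis on ONE sector
  sequence `M L`.
Typing authority: theory seat `hubbard-h0-rotor-theory-1`, cycle 9.  Nothing here claims H1‴ or H1⁗.
-/

set_option linter.dupNamespace false

noncomputable section

open Finset Filter Topology
open Literature.MathematicalPhysics.QuantumLattice hiding torusPhase torusNorm
open Literature.Probability.LatticeModels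

namespace Summit.HubbardSuperconductivity.HubbardSuperconductivity.Theorems.AnisotropyChord.InsertionEntropy

section OneStateCrux

/-! ## Part D — the one-state crux `TeleEntropyBound` and its link to `EventualCondensate` (memo §130(d)) -/

/-- **CONJECTURE H1‴ — `TeleEntropyBound` (one-state form of the condensation crux; OPEN).**  Along the sector
sequence `M L` there is `K` such that, eventually in `L`, for every Perron sector ground amplitude `aN` of `H(Δ)`
in the sector `M L` and all sites `x ≠ y`: `ν_x^{(y)} ≪ ν_y^{(x)}` and `KL(ν_x^{(y)} ‖ ν_y^{(x)}) ≤ K`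
(«the other particles cannot tell, in relative entropy, whether the tagged particle is at `x` or at `y`»).
Gaussian value `|Λ|⁻¹ Σ_k |û(k)|² |1 − e^{ik·(x−y)}|² ρ S(k)`, bounded in `d = 2` under (S)+(K), `≍ log|x − y|` in
`d = 1`. [conjecture: theory seat hubbard-h0-rotor-theory-1, cycle 9, 2026-08-28 — memo ROTOR-THEORY-9 §130(d) (OPEN)] -/
def TeleEntropyBound (Δ : ℝ) (M : ℕ → ℝ) : Prop :=
  ∃ K : ℝ, ∀ᶠ L : ℕ in atTop, ∀ [NeZero L], ∀ aN : TensorIndex (TorusSite 2 L) 2 → ℝ,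
    IsPerronSectorGroundAmplitude L Δ (M L) aN → ∀ x y : TorusSite 2 L, x ≠ y →
      (∀ τ, 0 < teleLaw aN x y τ → 0 < teleLaw aN y x τ) ∧
        klDiv (teleLaw aN x y) (teleLaw aN y x) ≤ K

/-- **One-state floor for a Perron sector ground amplitude of the XXZ torus** (Part C + tree uniform density +
sector counting): `n₀/|Λ| ≥ ρ_L (1 − ρ_L) e^{−K/2}`, `ρ_L = 1/2 + M/L²`. Theory seat memo ROTOR-THEORY-9 §130(d). [folklore] -/
theorem condensateDensity_ge_of_isPerron_tele (L : ℕ) [NeZero L] (Δ Mv K : ℝ)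
    (aN : TensorIndex (TorusSite 2 L) 2 → ℝ) (ha : IsPerronSectorGroundAmplitude L Δ Mv aN)
    (hac : ∀ x y τ, x ≠ y → 0 < teleLaw aN x y τ → 0 < teleLaw aN y x τ)
    (hK : ∀ x y, x ≠ y → klDiv (teleLaw aN x y) (teleLaw aN y x) ≤ K) :
    (1 / 2 + Mv / (L : ℝ) ^ 2) * (1 - (1 / 2 + Mv / (L : ℝ) ^ 2)) * Real.exp (-K / 2)
      ≤ condensateDensity aN := by
  have hL : (0 : ℝ) < (L : ℝ) := by exact_mod_cast Nat.pos_of_ne_zero (NeZero.ne L)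
  have hcard : (Fintype.card (TorusSite 2 L) : ℝ) = (L : ℝ) ^ 2 := by
    have h : Fintype.card (TorusSite 2 L) = L ^ 2 := by
      rw [Fintype.card_fun, ZMod.card, Fintype.card_fin]
    rw [h]; push_cast; ring
  set N : ℝ := (Fintype.card (TorusSite 2 L) : ℝ) / 2 + Mv with hNdef
  have hsect : ∀ σ, aN σ ≠ 0 → ((univ.filter fun z => σ z = 0).card : ℝ) = N := by
    intro σ hσ
    exact card_filter_eq_zero_of_mem_sector ha.sector (by exact_mod_cast hσ : (aN σ : ℂ) ≠ 0)
  have main := condensateDensity_ge_of_teleEntropy' aN N (1 / 2 + Mv / (L : ℝ) ^ 2) K ha.nonneg ha.unit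
    hsect (fun x => siteDensity_eq_of_isPerron L Δ Mv aN ha x) hac hK
  have hρ : N / (Fintype.card (TorusSite 2 L) : ℝ) = 1 / 2 + Mv / (L : ℝ) ^ 2 := by
    rw [hNdef, hcard]
    field_simp
  rw [hρ] at main
  exact main

/-- **LINK′ (PROVED).**  `TeleEntropyBound` along a sequence of densities `ρ_L → ρ ∈ (0,1)` ⇒ eventual condensation,
with the explicit floor `(ρ/2)((1−ρ)/2) e^{−K/2}`.  One-state analogue of `eventualCondensate_of_insertionEntropyBound`
(no uniform-density or Perron-existence hypotheses: both are tree theorems / not needed). Theory seat memo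
ROTOR-THEORY-9 §130(d). [folklore] -/
theorem eventualCondensate_of_teleEntropyBound (Δ : ℝ) (M : ℕ → ℝ) (ρ : ℝ)
    (hρ : ρ ∈ Set.Ioo (0 : ℝ) 1)
    (hlim : Tendsto (fun L : ℕ => 1 / 2 + M L / (L : ℝ) ^ 2) atTop (𝓝 ρ))
    (hT : TeleEntropyBound Δ M) :
    EventualCondensate Δ M := by
  obtain ⟨K, hK⟩ := hT
  have hρ0 : 0 < ρ := hρ.1
  have hρ1 : ρ < 1 := hρ.2
  have hlow : ∀ᶠ L : ℕ in atTop, ρ / 2 ≤ 1 / 2 + M L / (L : ℝ) ^ 2 :=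
    hlim.eventually (eventually_ge_nhds (by linarith : ρ / 2 < ρ))
  have hup : ∀ᶠ L : ℕ in atTop, 1 / 2 + M L / (L : ℝ) ^ 2 ≤ (1 + ρ) / 2 :=
    hlim.eventually (eventually_le_nhds (by linarith : ρ < (1 + ρ) / 2))
  refine ⟨ρ / 2 * ((1 - ρ) / 2) * Real.exp (-K / 2), by
    have : 0 < 1 - ρ := by linarith
    positivity, ?_⟩
  filter_upwards [hK, hlow, hup] with L hKL hlo hhi
  intro _ aN haN
  have main := condensateDensity_ge_of_isPerron_tele L Δ (M L) K aN haN
    (fun x y τ hxy => (hKL aN haN x y hxy).1 τ) (fun x y hxy => (hKL aN haN x y hxy).2)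
  refine le_trans ?_ main
  have h1 : ρ / 2 * ((1 - ρ) / 2) ≤ (1 / 2 + M L / (L : ℝ) ^ 2) * (1 - (1 / 2 + M L / (L : ℝ) ^ 2)) := by
    apply mul_le_mul hlo (by linarith) (by linarith) (le_trans (by linarith) hlo)
  exact mul_le_mul_of_nonneg_right h1 (le_of_lt (Real.exp_pos _))

end OneStateCrux

section OneStateGaussian

/-! ## Part E — the one-state GAUSSIAN value and the comparison crux H1⁗ (memo §133) -/

/-- One-state Gaussian («harmonic-fluid») teleportation entropy
`vG_a(x,y) = L⁻² Σ_{k≠0} (S_a(k)/(1−P/L²) − 1)² ‖1 − e^{2πik·(y−x)/L}‖² / (4 (P/L²) S_a(k))`: the harmonic-fluid value of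
`D_½(ν_x^{(y)}, ν_y^{(x)})` (kernel `û = (S/(1−ρ) − 1)/(2ρS)`; ED/closed form `D_½/vG → 1`, kit j302351). A functional of the
structure factor of the SAME state. (theory seat `hubbard-h0-rotor-theory-1`, memo ROTOR-THEORY-9 §133) [folklore] -/
def teleGaussianEntropy (L : ℕ) [NeZero L] (a : TensorIndex (TorusSite 2 L) 2 → ℝ) (P : ℝ)
    (x y : TorusSite 2 L) : ℝ :=
  ∑ k ∈ univ.filter (fun k : TorusSite 2 L => k ≠ 0),
    (structureFactor L a P k / (1 - P / (L : ℝ) ^ 2) - 1) ^ 2 * ‖1 - torusPhase L k (y - x)‖ ^ 2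
      / (4 * (P / (L : ℝ) ^ 2) * structureFactor L a P k) / (L : ℝ) ^ 2

/-- **CONJECTURE H1⁗ — `TeleGaussianComparison` (one-state Gaussian domination; OPEN, summit-class).**
Eventually in `L`, for every Perron sector ground amplitude of sector `M L` and all `x ≠ y`:
`ν_x^{(y)} ≪ ν_y^{(x)}` and `KL(ν_x^{(y)} ‖ ν_y^{(x)}) ≤ C · vG(x,y) + C'`.  Every quantity refers to ONE state.
ED/closed form (kit j302351): `D_½/vG = 0.92–0.99 ↑ 1` on rings (all `Δ` tested, where `vG ≍ K⁻¹ log|x−y|` reproduces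
the Luttinger exponent) and `≈ 0.99` on 2D tori; `KL/D_½ = 1.93–2.00`.  Remaining summit-class input behind it
(memo §133, census R7): a conditional CLT with variance control for the antisymmetric log-teleportation ratio.
[conjecture: theory seat hubbard-h0-rotor-theory-1, cycle 9, 2026-08-28 — memo ROTOR-THEORY-9 §133 (OPEN)] -/
def TeleGaussianComparison (Δ : ℝ) (M : ℕ → ℝ) : Prop :=
  ∃ C C' : ℝ, ∀ᶠ L : ℕ in atTop, ∀ [NeZero L], ∀ aN : TensorIndex (TorusSite 2 L) 2 → ℝ,
    IsPerronSectorGroundAmplitude L Δ (M L) aN → ∀ x y : TorusSite 2 L, x ≠ y →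
      (∀ τ, 0 < teleLaw aN x y τ → 0 < teleLaw aN y x τ) ∧
        klDiv (teleLaw aN x y) (teleLaw aN y x)
          ≤ C * teleGaussianEntropy L aN ((L : ℝ) ^ 2 / 2 + M L) x y + C'

/-- (IR_α)^N — the infrared structure bound for the `N`-sector Perron states themselves: `S(k) ≥ c|k|_T^α`, `α < 2`,
eventually in `L`, all `k ≠ 0` (the tree's `InfraredStructureBound Δ M` is the same statement for the sector `M L − 1`;
supplied by (S_Υ) via THEOREM TWIST-IR). [conjecture: theory seat hubbard-h0-rotor-theory-1, cycle 9, 2026-08-28 — N-sector transcription of the tree's InfraredStructureBound (memo ROTOR-THEORY-9 §133)] -/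
def InfraredStructureBoundN (Δ : ℝ) (M : ℕ → ℝ) : Prop :=
  ∃ c > (0 : ℝ), ∃ α < (2 : ℝ), ∀ᶠ L : ℕ in atTop, ∀ [NeZero L],
    ∀ aN : TensorIndex (TorusSite 2 L) 2 → ℝ, IsPerronSectorGroundAmplitude L Δ (M L) aN →
      ∀ k : TorusSite 2 L, k ≠ 0 → c * (torusNorm L k) ^ α ≤ structureFactor L aN ((L : ℝ) ^ 2 / 2 + M L) k

/-- (S_max)^N — `S(k) ≤ S_max` for the `N`-sector Perron states (the `M L` half of the tree's two-sector
`StructureFactorUpper Δ M`; supplied by (K) and the f-sum rule, tree `structureFactorUpper_of_susceptibility`).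
[conjecture: theory seat hubbard-h0-rotor-theory-1, cycle 9, 2026-08-28 — N-sector half of the tree's StructureFactorUpper (memo ROTOR-THEORY-9 §133)] -/
def StructureFactorUpperN (Δ : ℝ) (M : ℕ → ℝ) : Prop :=
  ∃ Smax : ℝ, ∀ᶠ L : ℕ in atTop, ∀ [NeZero L],
    ∀ aN : TensorIndex (TorusSite 2 L) 2 → ℝ, IsPerronSectorGroundAmplitude L Δ (M L) aN →
      ∀ k : TorusSite 2 L, k ≠ 0 → structureFactor L aN ((L : ℝ) ^ 2 / 2 + M L) k ≤ Smax

/-- The `N`-sector upper structure bound is the `M L` half of the tree's two-sector `StructureFactorUpper`. [folklore] -/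
theorem structureFactorUpperN_of_structureFactorUpper (Δ : ℝ) (M : ℕ → ℝ) (h : StructureFactorUpper Δ M) :
    StructureFactorUpperN Δ M := by
  obtain ⟨Smax, hS⟩ := h
  refine ⟨Smax, ?_⟩
  filter_upwards [hS] with L hL
  intro _ aN haN k hk
  exact hL aN (M L) (by simp) haN k hk

/-- **Finite-volume bound on vG:** if `c|k|_T^α ≤ S(k) ≤ S_max` (`k ≠ 0`) and `0 < ρ = P/L² < 1` then
`vG(x,y) ≤ ((S_max/(1−ρ) + 1)²/(ρ c)) · L⁻² Σ_{k≠0} |k|_T^{−α}`. Theory seat memo ROTOR-THEORY-9 §133. [folklore] -/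
theorem teleGaussianEntropy_le {L : ℕ} [NeZero L] (a : TensorIndex (TorusSite 2 L) 2 → ℝ) (P : ℝ)
    (x y : TorusSite 2 L) (c α Smax : ℝ) (hc : 0 < c)
    (hρ0 : 0 < P / (L : ℝ) ^ 2) (hρ1 : P / (L : ℝ) ^ 2 < 1)
    (hIR : ∀ k : TorusSite 2 L, k ≠ 0 → c * (torusNorm L k) ^ α ≤ structureFactor L a P k)
    (hUp : ∀ k : TorusSite 2 L, k ≠ 0 → structureFactor L a P k ≤ Smax) :
    teleGaussianEntropy L a P x y
      ≤ (Smax / (1 - P / (L : ℝ) ^ 2) + 1) ^ 2 / (P / (L : ℝ) ^ 2 * c)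
          * ((∑ k ∈ univ.filter (fun k : TorusSite 2 L => k ≠ 0), (torusNorm L k) ^ (-α)) / (L : ℝ) ^ 2) := by
  have hL : (0 : ℝ) < (L : ℝ) := by exact_mod_cast Nat.pos_of_ne_zero (NeZero.ne L)
  have hL2 : (0 : ℝ) < (L : ℝ) ^ 2 := by positivity
  have h1ρ : 0 < 1 - P / (L : ℝ) ^ 2 := by linarith
  unfold teleGaussianEntropy
  rw [Finset.sum_div, Finset.mul_sum]
  refine Finset.sum_le_sum fun k hk => ?_
  have hk0 : k ≠ 0 := (Finset.mem_filter.mp hk).2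
  have hnk : 0 < torusNorm L k := torusNorm_pos hk0
  have hpow : 0 < (torusNorm L k) ^ α := Real.rpow_pos_of_pos hnk α
  have hSlo : c * (torusNorm L k) ^ α ≤ structureFactor L a P k := hIR k hk0
  have hS0 : 0 < structureFactor L a P k := lt_of_lt_of_le (by positivity) hSlo
  have hSup : structureFactor L a P k ≤ Smax := hUp k hk0
  have hSmax0 : 0 ≤ Smax := le_trans hS0.le hSup
  have hph : ‖1 - torusPhase L k (y - x)‖ ^ 2 ≤ 4 := by
    have h1 : ‖1 - torusPhase L k (y - x)‖ ≤ 2 := by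
      calc ‖1 - torusPhase L k (y - x)‖ ≤ ‖(1 : ℂ)‖ + ‖torusPhase L k (y - x)‖ := norm_sub_le _ _
        _ = 2 := by rw [norm_one, norm_torusPhase]; norm_num
    nlinarith [norm_nonneg (1 - torusPhase L k (y - x))]
  have hsq : (structureFactor L a P k / (1 - P / (L : ℝ) ^ 2) - 1) ^ 2
      ≤ (Smax / (1 - P / (L : ℝ) ^ 2) + 1) ^ 2 := by
    have h0 : 0 ≤ structureFactor L a P k / (1 - P / (L : ℝ) ^ 2) := div_nonneg hS0.le h1ρ.le
    have h0' : 0 ≤ Smax / (1 - P / (L : ℝ) ^ 2) := div_nonneg hSmax0 h1ρ.le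
    have hhi : structureFactor L a P k / (1 - P / (L : ℝ) ^ 2) ≤ Smax / (1 - P / (L : ℝ) ^ 2) :=
      div_le_div_of_nonneg_right hSup h1ρ.le
    exact sq_le_sq' (by linarith) (by linarith)
  have hden : 4 * (P / (L : ℝ) ^ 2) * (c * (torusNorm L k) ^ α)
      ≤ 4 * (P / (L : ℝ) ^ 2) * structureFactor L a P k :=
    mul_le_mul_of_nonneg_left hSlo (by positivity)
  have hden0 : 0 < 4 * (P / (L : ℝ) ^ 2) * (c * (torusNorm L k) ^ α) := by positivity
  calc (structureFactor L a P k / (1 - P / (L : ℝ) ^ 2) - 1) ^ 2 * ‖1 - torusPhase L k (y - x)‖ ^ 2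
          / (4 * (P / (L : ℝ) ^ 2) * structureFactor L a P k) / (L : ℝ) ^ 2
      ≤ (Smax / (1 - P / (L : ℝ) ^ 2) + 1) ^ 2 * 4
          / (4 * (P / (L : ℝ) ^ 2) * (c * (torusNorm L k) ^ α)) / (L : ℝ) ^ 2 := by
        apply div_le_div_of_nonneg_right _ hL2.le
        calc (structureFactor L a P k / (1 - P / (L : ℝ) ^ 2) - 1) ^ 2 * ‖1 - torusPhase L k (y - x)‖ ^ 2
                / (4 * (P / (L : ℝ) ^ 2) * structureFactor L a P k)
            ≤ (Smax / (1 - P / (L : ℝ) ^ 2) + 1) ^ 2 * 4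
                / (4 * (P / (L : ℝ) ^ 2) * structureFactor L a P k) := by
              apply div_le_div_of_nonneg_right _ (by positivity)
              exact mul_le_mul hsq hph (sq_nonneg _) (sq_nonneg _)
          _ ≤ (Smax / (1 - P / (L : ℝ) ^ 2) + 1) ^ 2 * 4
                / (4 * (P / (L : ℝ) ^ 2) * (c * (torusNorm L k) ^ α)) :=
              div_le_div_of_nonneg_left (by positivity) hden0 hden
    _ = (Smax / (1 - P / (L : ℝ) ^ 2) + 1) ^ 2 / (P / (L : ℝ) ^ 2 * c)
          * ((torusNorm L k) ^ (-α) / (L : ℝ) ^ 2) := by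
        rw [Real.rpow_neg hnk.le]
        field_simp

/-- **REDUCTION (PROVED): H1⁗ ∧ (IR_α)^N ∧ (S ≤ S_max)^N ∧ ρ_L → ρ ∈ (0,1) ⇒ H1‴ (`TeleEntropyBound`).**
The lattice sum `L⁻² Σ_{k≠0}|k|_T^{−α} ≤ (2π)^{−α}(1 + 2/(1−α/2))²` (tree `sum_rpow_neg_torusNorm_le`, `0 ≤ α < 2`) makes the
Gaussian value uniformly bounded in `d = 2` (a negative `α` is first raised to `0` using `|k|_T ≤ π√2`). Theory seat memo
ROTOR-THEORY-9 §133. [folklore] -/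
theorem teleEntropyBound_of_gaussianComparison (Δ : ℝ) (M : ℕ → ℝ) (ρ : ℝ)
    (hρ : ρ ∈ Set.Ioo (0 : ℝ) 1)
    (hlim : Tendsto (fun L : ℕ => 1 / 2 + M L / (L : ℝ) ^ 2) atTop (𝓝 ρ))
    (hG : TeleGaussianComparison Δ M) (hIR : InfraredStructureBoundN Δ M)
    (hUp : StructureFactorUpperN Δ M) : TeleEntropyBound Δ M := by
  obtain ⟨C, C', hC⟩ := hG
  obtain ⟨c, hc, α, hα, hI⟩ := hIR
  obtain ⟨Smax, hS⟩ := hUp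
  have hρ0 : 0 < ρ := hρ.1
  have hρ1 : ρ < 1 := hρ.2
  have hlow : ∀ᶠ L : ℕ in atTop, ρ / 2 ≤ 1 / 2 + M L / (L : ℝ) ^ 2 :=
    hlim.eventually (eventually_ge_nhds (by linarith : ρ / 2 < ρ))
  have hup : ∀ᶠ L : ℕ in atTop, 1 / 2 + M L / (L : ℝ) ^ 2 ≤ (1 + ρ) / 2 :=
    hlim.eventually (eventually_le_nhds (by linarith : ρ < (1 + ρ) / 2))
  -- exponent raised to α' = max α 0
  obtain ⟨α', hα'eq⟩ : ∃ α' : ℝ, α' = max α 0 := ⟨_, rfl⟩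
  have hα'0 : 0 ≤ α' := by rw [hα'eq]; exact le_max_right _ _
  have hα'2 : α' < 2 := by rw [hα'eq]; exact max_lt hα (by norm_num)
  have hαle : α ≤ α' := by rw [hα'eq]; exact le_max_left _ _
  have hps : 0 < Real.pi * Real.sqrt 2 := by positivity
  obtain ⟨c', hc'eq⟩ : ∃ c' : ℝ, c' = c * (Real.pi * Real.sqrt 2) ^ (-(α' - α)) := ⟨_, rfl⟩
  have hc'0 : 0 < c' := by rw [hc'eq]; positivity
  obtain ⟨K₁, hK₁⟩ : ∃ K₁ : ℝ, K₁ = (2 * Real.pi) ^ (-α') * (1 + 2 / (1 - α' / 2)) ^ 2 := ⟨_, rfl⟩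
  have hw2 : 0 < 1 - (1 + ρ) / 2 := by linarith
  obtain ⟨A, hA⟩ : ∃ A : ℝ, A = (|Smax| / (1 - (1 + ρ) / 2) + 1) ^ 2 / (ρ / 2 * c') := ⟨_, rfl⟩
  have hA0 : 0 ≤ A := by rw [hA]; positivity
  refine ⟨|C| * (A * K₁) + C', ?_⟩
  filter_upwards [hC, hI, hS, hlow, hup] with L hCL hIL hSL hlo hhi
  intro _ aN haN x y hxy
  obtain ⟨hac, hKL⟩ := hCL aN haN x y hxy
  refine ⟨hac, le_trans hKL ?_⟩
  have hL : (0 : ℝ) < (L : ℝ) := by exact_mod_cast Nat.pos_of_ne_zero (NeZero.ne L)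
  have hL2 : (0 : ℝ) < (L : ℝ) ^ 2 := by positivity
  have hP : ((L : ℝ) ^ 2 / 2 + M L) / (L : ℝ) ^ 2 = 1 / 2 + M L / (L : ℝ) ^ 2 := by
    field_simp
  have hρL0 : 0 < ((L : ℝ) ^ 2 / 2 + M L) / (L : ℝ) ^ 2 := by rw [hP]; linarith
  have hρL1 : ((L : ℝ) ^ 2 / 2 + M L) / (L : ℝ) ^ 2 < 1 := by rw [hP]; linarith
  -- IR bound with exponent α' ≥ α
  have hIR' : ∀ k : TorusSite 2 L, k ≠ 0 →
      c' * (torusNorm L k) ^ α' ≤ structureFactor L aN ((L : ℝ) ^ 2 / 2 + M L) k := by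
    intro k hk
    refine le_trans ?_ (hIL aN haN k hk)
    have hnk : 0 < torusNorm L k := torusNorm_pos hk
    have hle : torusNorm L k ≤ Real.pi * Real.sqrt 2 := torusNorm_le k
    have h1 : (torusNorm L k) ^ α' = (torusNorm L k) ^ α * (torusNorm L k) ^ (α' - α) := by
      rw [← Real.rpow_add hnk]; ring_nf
    have h2 : (torusNorm L k) ^ (α' - α) ≤ (Real.pi * Real.sqrt 2) ^ (α' - α) :=
      Real.rpow_le_rpow hnk.le hle (by linarith)
    have h3 : (Real.pi * Real.sqrt 2) ^ (-(α' - α)) * (Real.pi * Real.sqrt 2) ^ (α' - α) = 1 := by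
      rw [← Real.rpow_add hps]; simp
    have hcp : 0 ≤ c * (torusNorm L k) ^ α := by positivity
    have hpp : 0 ≤ (Real.pi * Real.sqrt 2) ^ (-(α' - α)) := by positivity
    calc c' * (torusNorm L k) ^ α'
        = c * (torusNorm L k) ^ α * ((Real.pi * Real.sqrt 2) ^ (-(α' - α)) * (torusNorm L k) ^ (α' - α)) := by
          rw [hc'eq, h1]; ring
      _ ≤ c * (torusNorm L k) ^ α * ((Real.pi * Real.sqrt 2) ^ (-(α' - α)) * (Real.pi * Real.sqrt 2) ^ (α' - α)) :=
          mul_le_mul_of_nonneg_left (mul_le_mul_of_nonneg_left h2 hpp) hcp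
      _ = c * (torusNorm L k) ^ α := by rw [h3, mul_one]
  have main := teleGaussianEntropy_le aN ((L : ℝ) ^ 2 / 2 + M L) x y c' α' Smax hc'0 hρL0 hρL1 hIR'
    (fun k hk => hSL aN haN k hk)
  have hsum : (∑ k ∈ univ.filter (fun k : TorusSite 2 L => k ≠ 0), (torusNorm L k) ^ (-α')) / (L : ℝ) ^ 2
      ≤ K₁ := by
    rw [hK₁, div_le_iff₀ hL2]; exact sum_rpow_neg_torusNorm_le hα'0 hα'2
  have hsum0 : 0 ≤ (∑ k ∈ univ.filter (fun k : TorusSite 2 L => k ≠ 0), (torusNorm L k) ^ (-α')) / (L : ℝ) ^ 2 :=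
    div_nonneg (Finset.sum_nonneg fun k _ => Real.rpow_nonneg (torusNorm_nonneg k) _) hL2.le
  -- coefficient ≤ A on the density window
  have hcoef : (Smax / (1 - ((L : ℝ) ^ 2 / 2 + M L) / (L : ℝ) ^ 2) + 1) ^ 2
        / (((L : ℝ) ^ 2 / 2 + M L) / (L : ℝ) ^ 2 * c') ≤ A := by
    rw [hP, hA]
    have hw0 : 0 < 1 - (1 / 2 + M L / (L : ℝ) ^ 2) := by linarith
    have hw1 : 1 - (1 + ρ) / 2 ≤ 1 - (1 / 2 + M L / (L : ℝ) ^ 2) := by linarith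
    have hx0 : 0 ≤ |Smax| / (1 - (1 + ρ) / 2) := div_nonneg (abs_nonneg _) hw2.le
    have hup' : |Smax| / (1 - (1 / 2 + M L / (L : ℝ) ^ 2)) ≤ |Smax| / (1 - (1 + ρ) / 2) :=
      div_le_div_of_nonneg_left (abs_nonneg _) hw2 hw1
    have hhi : Smax / (1 - (1 / 2 + M L / (L : ℝ) ^ 2)) ≤ |Smax| / (1 - (1 + ρ) / 2) :=
      le_trans (div_le_div_of_nonneg_right (le_abs_self Smax) hw0.le) hup'
    have hlo' : -(|Smax| / (1 - (1 + ρ) / 2)) ≤ Smax / (1 - (1 / 2 + M L / (L : ℝ) ^ 2)) := by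
      have h1 : -|Smax| / (1 - (1 / 2 + M L / (L : ℝ) ^ 2)) ≤ Smax / (1 - (1 / 2 + M L / (L : ℝ) ^ 2)) :=
        div_le_div_of_nonneg_right (neg_abs_le Smax) hw0.le
      rw [neg_div] at h1
      linarith
    have hnum : (Smax / (1 - (1 / 2 + M L / (L : ℝ) ^ 2)) + 1) ^ 2 ≤ (|Smax| / (1 - (1 + ρ) / 2) + 1) ^ 2 :=
      sq_le_sq' (by linarith) (by linarith)
    have hden : ρ / 2 * c' ≤ (1 / 2 + M L / (L : ℝ) ^ 2) * c' := mul_le_mul_of_nonneg_right hlo hc'0.le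
    have hden0 : 0 < ρ / 2 * c' := by positivity
    have hden1 : 0 < (1 / 2 + M L / (L : ℝ) ^ 2) * c' := by
      have : 0 < 1 / 2 + M L / (L : ℝ) ^ 2 := by linarith
      positivity
    calc (Smax / (1 - (1 / 2 + M L / (L : ℝ) ^ 2)) + 1) ^ 2 / ((1 / 2 + M L / (L : ℝ) ^ 2) * c')
        ≤ (|Smax| / (1 - (1 + ρ) / 2) + 1) ^ 2 / ((1 / 2 + M L / (L : ℝ) ^ 2) * c') :=
          div_le_div_of_nonneg_right hnum hden1.le
      _ ≤ (|Smax| / (1 - (1 + ρ) / 2) + 1) ^ 2 / (ρ / 2 * c') :=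
          div_le_div_of_nonneg_left (sq_nonneg _) hden0 hden
  have hvG : teleGaussianEntropy L aN ((L : ℝ) ^ 2 / 2 + M L) x y ≤ A * K₁ :=
    le_trans main (mul_le_mul hcoef hsum hsum0 hA0)
  have hvG0 : 0 ≤ teleGaussianEntropy L aN ((L : ℝ) ^ 2 / 2 + M L) x y := by
    unfold teleGaussianEntropy
    refine Finset.sum_nonneg fun k hk => ?_
    have hk0 : k ≠ 0 := (Finset.mem_filter.mp hk).2
    have hnk : 0 < torusNorm L k := torusNorm_pos hk0
    have hc0 : 0 ≤ c' * (torusNorm L k) ^ α' := by positivity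
    have hS0 : 0 ≤ structureFactor L aN ((L : ℝ) ^ 2 / 2 + M L) k := le_trans hc0 (hIR' k hk0)
    have hd : 0 ≤ 4 * (((L : ℝ) ^ 2 / 2 + M L) / (L : ℝ) ^ 2) * structureFactor L aN ((L : ℝ) ^ 2 / 2 + M L) k :=
      mul_nonneg (mul_nonneg (by norm_num) hρL0.le) hS0
    exact div_nonneg (div_nonneg (mul_nonneg (sq_nonneg _) (sq_nonneg _)) hd) hL2.le
  calc C * teleGaussianEntropy L aN ((L : ℝ) ^ 2 / 2 + M L) x y + C'
      ≤ |C| * teleGaussianEntropy L aN ((L : ℝ) ^ 2 / 2 + M L) x y + C' := by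
        nlinarith [le_abs_self C, hvG0]
    _ ≤ |C| * (A * K₁) + C' := by
        nlinarith [abs_nonneg C, hvG]

/-- **ONE-STATE SKELETON (PROVED): H1⁗ ∧ (IR_α)^N ∧ (S ≤ S_max)^N ∧ ρ_L → ρ ∈ (0,1) ⇒ `EventualCondensate`.**
With (IR_α)^N ⟸ (S_Υ)^N (THEOREM TWIST-IR) and (S_max)^N ⟸ (K)^N (`structureFactorUpper_of_susceptibility`), the
one-state chain «stiffness + compressibility + Gaussian domination of ONE conditional pair ⇒ BEC» is complete, every
hypothesis referring to the single sector sequence `M L`. Theory seat memo ROTOR-THEORY-9 §133. [folklore] -/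
theorem eventualCondensate_of_teleGaussianComparison (Δ : ℝ) (M : ℕ → ℝ) (ρ : ℝ)
    (hρ : ρ ∈ Set.Ioo (0 : ℝ) 1)
    (hlim : Tendsto (fun L : ℕ => 1 / 2 + M L / (L : ℝ) ^ 2) atTop (𝓝 ρ))
    (hG : TeleGaussianComparison Δ M) (hIR : InfraredStructureBoundN Δ M)
    (hUp : StructureFactorUpperN Δ M) : EventualCondensate Δ M :=
  eventualCondensate_of_teleEntropyBound Δ M ρ hρ hlim
    (teleEntropyBound_of_gaussianComparison Δ M ρ hρ hlim hG hIR hUp)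

end OneStateGaussian

end Summit.HubbardSuperconductivity.HubbardSuperconductivity.Theorems.AnisotropyChord.InsertionEntropy
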